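import Literature.Computability.QuantumComplexity.OversamplingClosure
import HarnessLib

/-!
# `SQ_φ(A)` gives `SQ_{≤2φ}(SA)` and `SQ_{≤2φ}((SA)ᵀ)` for an importance-sampling sketch `S`
# (CGLLTW 2022, §2.3 Lemma 2.14 "sq-sketching", with Remark 2.13)

Chia, Gilyén, Li, Lin, Tang, Wang, J. ACM 69(5):33 (2022) = arXiv:1910.06151, **§2.3 "Matrix
sketches"** (held arXiv text p. 16 L23–63):

> **Definition 2.12.** For a distribution `p ∈ ℝᵐ`, we say that a matrix `S ∈ ℝ^{s×m}` is sampled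
> according to `p` if each row of `S` is independently chosen to be `e_i/√(s p(i))` with probability
> `p_i`. […] we call them `φ`-oversampled importance sampling sketches if `p` comes from `SQ_φ(A)`.
>
> **Remark 2.13.** […] `‖[SA](i,·)‖ = ‖A(s_i,·)‖/√(s·p(s_i))` [sic: the print has `p(i)` in the
> denominator (held text p. 16 L37); the sampled row is `s_i`, so `p(s_i)` is meant — referee
> R-SOA-1] `≤ √(φ/s)‖A‖_F` and, consequently, `‖SA‖_F ≤ √φ‖A‖_F`. When `φ = 1`, these
> inequalities are equalities.
>
> If we have `SQ_φ(A)`, we can efficiently create a `φ`-oversampling sketch `S` […]: for each row of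
> `S`, we pull a sample from `p`, and then compute `√p(i)`. After finding this sketch `S`, we have an
> implicit description of `SA`: it is a normalized multiset of rows of `A`, so we can describe it with
> the row indices and corresponding normalization, `(i_1,c_1),…,(i_s,c_s)`.
>
> **Lemma 2.14.** Consider `SQ_ϕ(A) ∈ ℂ^{m×n}` and `S ∈ ℝ^{r×m}` sampled according to `ã`, described
> as pairs `(i_1,c_1),…,(i_r,c_r)`. If `r ≥ 2ϕ² ln(2/δ)`, then with probability `≥ 1−δ`, we have
> `SQ_φ(SA)` and `SQ_φ((SA)†)` for some `φ` satisfying `φ ≤ 2ϕ`. If `ϕ = 1`, then for all `r`, we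
> have `SQ(SA)` and `SQ((SA)†)`. [runtimes …]
>
> So, if we have a matrix `A`, along with `SQ(A)`, we can find a sketch `S` of `A`, and then use the
> resulting `SQ((SA)†)` to find a sketch `T†` of `(SA)†`. […] This fully sketched down version of `A`,
> `SAT`, will be used extensively.

The (deferred) proof: the witness for `SA` is `SÃ` (the same rows of `Ã`, same normalisations); it
dominates `SA` entrywise, every row of `SÃ` has squared norm exactly `‖Ã‖_F²/r` (Remark 2.13 with
`φ = 1` for `Ã`), so `‖SÃ‖_F² = ‖Ã‖_F² = ϕ‖A‖_F²` and the oversampling factor of the pair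
`(SA, SÃ)` is `φ = ϕ‖A‖_F²/‖SA‖_F²`, which is `≤ 2ϕ` as soon as `‖SA‖_F² ≥ ½‖A‖_F²` — an event of
probability `≥ 1−δ` for `r ≥ 2ϕ² ln(1/δ)` by the lower tail of Lemma 5.1 (Hoeffding; the tree's
`iid_mass_sub_frobSq_sketch_ge_le_exp` with `η = 1/(2ϕ)`); transposition changes neither Frobenius
norms nor entrywise domination.  Sampling access: row `t` of `SÃ` is a rescaled row of `Ã`
(`lengthSqDist_sketch_mul_row`, in tree), the row-norm distribution of `SÃ` is uniform on `[r]`,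
and the row-norm distribution of `(SÃ)ᵀ` (= column norms of `SÃ`) is the uniform mixture of the
`𝒟_{Ã(i_t,·)}` — sample `t` uniformly, then `j ∼ 𝒟_{Ã(i_t,·)}`.

This file (real entries, as in the rest of the toolbox):
* `frobSq_transpose`, `MatrixOversamplingWitness.transpose` (`SQ_φ(A) → SQ_φ(Aᵀ)`, witness `Ãᵀ`);
* `sketch_sq_le_sketch_tilde_sq` (entrywise domination of `SA` by `SÃ`),
  `normSq_sketch_tilde_row` (each row of `SÃ` has squared norm `‖Ã‖_F²/r` on non-degenerate sample
  sequences), `frobSq_sketch_tilde_le` (`‖SÃ‖_F² ≤ ‖Ã‖_F² = ϕ‖A‖_F²`, always);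
* `sketchPhi W ω = ‖S_ωÃ‖_F²/‖S_ωA‖_F²` and `MatrixOversamplingWitness.sketched` — the witness
  `SQ_{sketchPhi}(S_ωA)` (for `S_ωA ≠ 0`), hence `SQ_{sketchPhi}((S_ωA)ᵀ)` by `transpose`;
* `sketchPhi_le_two_mul` (`‖S_ωA‖_F² ≥ ½‖A‖_F² ⇒ sketchPhi ≤ 2ϕ`), `sketchPhi_refl` (`ϕ = 1 ⇒ φ = 1`);
* `iid_mass_frobSq_sketch_lt_half_le` (mass{‖S_ωA‖_F² < ½‖A‖_F²} ≤ δ for `r ≥ 2ϕ² ln(1/δ)`) and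
  `sq_sketching` — **Lemma 2.14**: for `r ≥ 2ϕ² ln(2/δ)` (as printed; `ln(1/δ)` suffices) the
  sample sequences on which `S_ωA ≠ 0` and the witnesses `sketched`, `sketched.transpose` have
  oversampling factor `≤ 2ϕ` carry `𝒟_ã`-mass `≥ 1 − δ`;
* access identities `rowDist_sketch_tilde` (uniform) and `rowDist_transpose_sketch_tilde` (uniform
  mixture of `𝒟_{Ã(i_t,·)}`), and `iidWeight_eq_zero_of_rowDist_eq_zero` (degenerate sample
  sequences — a row of `𝒟_ã`-probability `0` drawn — have weight `0`).

No named facts are introduced; everything stated is proved.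

## References
* [ChiaEtAl2022] N.-H. Chia, A. Gilyén, T. Li, H.-H. Lin, E. Tang, C. Wang, J. ACM 69(5):33, 2022
  (= arXiv:1910.06151), §2.3 Def. 2.12, Remark 2.13, Lemma 2.14 (held text p. 16 L23–63); §5.2
  Lemma 5.1 (via `SketchNormConcentration`).
-/

noncomputable section

open scoped Matrix

namespace Literature.Computability.QuantumComplexity

namespace SampleQuery

open Finset Real

variable {m n r : ℕ} {φ : ℝ} {A : Matrix (Fin m) (Fin n) ℝ}

/-! ### Transposition -/

/-- `‖Aᵀ‖_F² = ‖A‖_F²`. [cite: ChiaEtAl2022, §2.1 notation] -/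
theorem frobSq_transpose (A : Matrix (Fin m) (Fin n) ℝ) : frobSq Aᵀ = frobSq A := by
  rw [frobSq_eq_sum_sq, frobSq_eq_sum_sq, sum_comm]
  rfl

namespace MatrixOversamplingWitness

/-- **`SQ_φ(A)` gives `SQ_φ(Aᵀ)`** with witness `Ãᵀ` (Frobenius norms and entrywise domination are
invariant under transposition; the sampling access to `Ãᵀ` is by columns of `Ã`, which is what
Lemma 2.14 provides for `Ã = SÃ'`). [cite: ChiaEtAl2022, §2.3 Lemma 2.14 ("we have `SQ_φ(SA)` and
`SQ_φ((SA)†)`")] -/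
def transpose (W : MatrixOversamplingWitness φ A) : MatrixOversamplingWitness φ Aᵀ where
  tilde := W.tildeᵀ
  frobSq_tilde := by rw [frobSq_transpose, frobSq_transpose, W.frobSq_tilde]
  sq_le i j := W.sq_le j i

/-- The witness of `SQ_φ(Aᵀ)` is `Ãᵀ`. [cite: ChiaEtAl2022, §2.3 Lemma 2.14] -/
@[simp] theorem transpose_tilde (W : MatrixOversamplingWitness φ A) : W.transpose.tilde = W.tildeᵀ :=
  rfl

end MatrixOversamplingWitness

/-! ### The sketched witness `SÃ` -/

/-- **Entrywise domination of `SA` by `SÃ`**: `[S_ωA](t,j)² ≤ [S_ωÃ](t,j)²` (same row `ω_t`, same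
normalisation `1/√(r p(ω_t))`). [cite: ChiaEtAl2022, §2.3 Lemma 2.14, proof (witness `SÃ`)] -/
theorem sketch_sq_le_sketch_tilde_sq (W : MatrixOversamplingWitness φ A) (p : Fin m → ℝ)
    (ω : Fin r → Fin m) (t : Fin r) (j : Fin n) :
    (sketch p ω * A) t j ^ 2 ≤ (sketch p ω * W.tilde) t j ^ 2 := by
  rw [sketch_mul_apply, sketch_mul_apply, div_pow, div_pow]
  exact div_le_div_of_nonneg_right (W.sq_le _ _) (sq_nonneg _)

/-- **Remark 2.13 with `φ = 1` for `Ã`**: on a sample sequence drawing only rows of positive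
`𝒟_ã`-probability, every row of `S_ωÃ` has squared norm exactly `‖Ã‖_F²/r`
("When `φ = 1`, these inequalities are equalities"). [cite: ChiaEtAl2022, §2.3 Remark 2.13] -/
theorem normSq_sketch_tilde_row (W : MatrixOversamplingWitness φ A) (ω : Fin r → Fin m) (t : Fin r)
    (hω : 0 < rowDist W.tilde (ω t)) :
    normSq ((sketch (rowDist W.tilde) ω * W.tilde) t) = frobSq W.tilde / r :=
  normSq_sketch_mul_row_eq W.tilde ω t hω

/-- **`‖S_ωÃ‖_F² ≤ ‖Ã‖_F²`** for every sample sequence (Remark 2.13, `‖SA‖_F ≤ √φ‖A‖_F`, applied to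
`Ã` with its exact importance sampling distribution, `φ = 1`). [cite: ChiaEtAl2022, §2.3
Remark 2.13] -/
theorem frobSq_sketch_tilde_le (W : MatrixOversamplingWitness φ A) (hA : A ≠ 0) (ω : Fin r → Fin m) :
    frobSq (sketch (rowDist W.tilde) ω * W.tilde) ≤ frobSq W.tilde := by
  have h1 : IsOversampledDist 1 (rowNorms W.tilde) (rowDist W.tilde) := by
    simpa using (MatrixOversamplingWitness.refl W.tilde).isOversampledDist_rowDist (W.tilde_ne_zero hA)
  simpa using frobSq_sketch_mul_le h1 one_pos ω

/-- The oversampling factor of the sketched pair `(S_ωA, S_ωÃ)`: `φ_ω = ‖S_ωÃ‖_F²/‖S_ωA‖_F²`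
("we have `SQ_φ(SA)` … for some `φ`"). [cite: ChiaEtAl2022, §2.3 Lemma 2.14] -/
def sketchPhi (W : MatrixOversamplingWitness φ A) (ω : Fin r → Fin m) : ℝ :=
  frobSq (sketch (rowDist W.tilde) ω * W.tilde) / frobSq (sketch (rowDist W.tilde) ω * A)

/-- `φ_ω ≥ 0`. [cite: ChiaEtAl2022, §2.3 Lemma 2.14] -/
theorem sketchPhi_nonneg (W : MatrixOversamplingWitness φ A) (ω : Fin r → Fin m) : 0 ≤ sketchPhi W ω :=
  div_nonneg (frobSq_nonneg _) (frobSq_nonneg _)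

namespace MatrixOversamplingWitness

/-- **`SQ_ϕ(A)` gives `SQ_{φ_ω}(S_ωA)` with witness `S_ωÃ`** (whenever `S_ωA ≠ 0`): `SÃ` dominates
`SA` entrywise and `‖S_ωÃ‖_F² = φ_ω‖S_ωA‖_F²` by the definition of `φ_ω`; with `transpose` this is
also `SQ_{φ_ω}((S_ωA)ᵀ)`. [cite: ChiaEtAl2022, §2.3 Lemma 2.14 ("we have `SQ_φ(SA)` and
`SQ_φ((SA)†)` for some `φ`")] -/
def sketched (W : MatrixOversamplingWitness φ A) (ω : Fin r → Fin m)
    (hne : sketch (rowDist W.tilde) ω * A ≠ 0) :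
    MatrixOversamplingWitness (sketchPhi W ω) (sketch (rowDist W.tilde) ω * A) where
  tilde := sketch (rowDist W.tilde) ω * W.tilde
  frobSq_tilde := by
    unfold sketchPhi
    rw [div_mul_cancel₀ _ (frobSq_pos hne).ne']
  sq_le t j := sketch_sq_le_sketch_tilde_sq W _ ω t j

/-- The witness of `SQ_{φ_ω}(S_ωA)` is `S_ωÃ`. [cite: ChiaEtAl2022, §2.3 Lemma 2.14] -/
@[simp] theorem sketched_tilde (W : MatrixOversamplingWitness φ A) (ω : Fin r → Fin m)
    (hne : sketch (rowDist W.tilde) ω * A ≠ 0) :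
    (W.sketched ω hne).tilde = sketch (rowDist W.tilde) ω * W.tilde := rfl

end MatrixOversamplingWitness

/-- **`φ_ω ≤ 2ϕ` on the good event**: if `‖S_ωA‖_F² ≥ ½‖A‖_F²` then
`φ_ω = ‖S_ωÃ‖_F²/‖S_ωA‖_F² ≤ ϕ‖A‖_F²/(½‖A‖_F²) = 2ϕ`. [cite: ChiaEtAl2022, §2.3 Lemma 2.14
("for some `φ` satisfying `φ ≤ 2ϕ`")] -/
theorem sketchPhi_le_two_mul (W : MatrixOversamplingWitness φ A) (hA : A ≠ 0) (ω : Fin r → Fin m)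
    (hω : frobSq A / 2 ≤ frobSq (sketch (rowDist W.tilde) ω * A)) : sketchPhi W ω ≤ 2 * φ := by
  have hF : 0 < frobSq A := frobSq_pos hA
  have hden : 0 < frobSq (sketch (rowDist W.tilde) ω * A) := lt_of_lt_of_le (by linarith) hω
  unfold sketchPhi
  rw [div_le_iff₀ hden]
  calc frobSq (sketch (rowDist W.tilde) ω * W.tilde) ≤ frobSq W.tilde := frobSq_sketch_tilde_le W hA ω
    _ = φ * frobSq A := W.frobSq_tilde
    _ = 2 * φ * (frobSq A / 2) := by ring
    _ ≤ 2 * φ * frobSq (sketch (rowDist W.tilde) ω * A) :=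
        mul_le_mul_of_nonneg_left hω (by linarith [W.pos hA])

/-- **`ϕ = 1`: for all `r` we have `SQ(SA)`** — with `Ã = A` the sketched pair is `(S_ωA, S_ωA)` and
`φ_ω = 1` (whenever `S_ωA ≠ 0`). [cite: ChiaEtAl2022, §2.3 Lemma 2.14 ("If `ϕ = 1`, then for all
`r`, we have `SQ(SA)` and `SQ((SA)†)`")] -/
theorem sketchPhi_refl (A : Matrix (Fin m) (Fin n) ℝ) (ω : Fin r → Fin m)
    (hne : sketch (rowDist A) ω * A ≠ 0) :
    sketchPhi (MatrixOversamplingWitness.refl A) ω = 1 := by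
  unfold sketchPhi
  rw [MatrixOversamplingWitness.refl_tilde]
  exact div_self (frobSq_pos hne).ne'

/-! ### The good event has probability `≥ 1 − δ` (Lemma 5.1, lower tail) -/

/-- **Lower tail**: for `r ≥ 2ϕ² ln(1/δ)` rows, the `𝒟_ã`-mass of the sample sequences with
`‖S_ωA‖_F² < ½‖A‖_F²` is at most `δ` (Lemma 5.1 / Hoeffding with deviation `½‖A‖_F² =
(1/(2ϕ))·ϕ‖A‖_F²`: `exp(−2r/(4ϕ²)) ≤ δ`). [cite: ChiaEtAl2022, §2.3 Lemma 2.14 ("If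
`r ≥ 2ϕ² ln(2/δ)`, then with probability `≥ 1−δ` …"), via §5.2 Lemma 5.1] -/
theorem iid_mass_frobSq_sketch_lt_half_le (W : MatrixOversamplingWitness φ A) (hA : A ≠ 0)
    (hr : 0 < r) {δ : ℝ} (hδ : 0 < δ) (hrδ : 2 * φ ^ 2 * Real.log (1 / δ) ≤ r) :
    ∑ ω ∈ univ.filter (fun ω : Fin r → Fin m =>
        frobSq (sketch (rowDist W.tilde) ω * A) < frobSq A / 2), iidWeight (rowDist W.tilde) ω ≤ δ := by
  classical
  have hp := W.isOversampledDist_rowDist hA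
  have hφ := W.pos hA
  have hη : (0 : ℝ) ≤ 1 / (2 * φ) := by positivity
  have htail := iid_mass_sub_frobSq_sketch_ge_le_exp hp hφ hA hr hη
  have hev : 1 / (2 * φ) * φ * frobSq A = frobSq A / 2 := by
    field_simp
  rw [hev] at htail
  refine le_trans (sum_le_sum_of_subset_of_nonneg (fun ω hω => ?_)
    (fun ω _ _ => iidWeight_nonneg hp.nonneg ω)) (htail.trans ?_)
  · simp only [mem_filter, mem_univ, true_and] at hω ⊢
    linarith
  · -- `exp(−2 r (1/(2φ))²) = exp(−r/(2φ²)) ≤ δ` iff `r ≥ 2φ² ln(1/δ)`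
    have hφ2 : 0 < 2 * φ ^ 2 := by positivity
    have hexp : -2 * (r : ℝ) * (1 / (2 * φ)) ^ 2 = -(r / (2 * φ ^ 2)) := by
      field_simp
    rw [hexp]
    have hlog : Real.log (1 / δ) ≤ r / (2 * φ ^ 2) := by
      rw [le_div_iff₀ hφ2]; linarith
    calc Real.exp (-(r / (2 * φ ^ 2))) ≤ Real.exp (-Real.log (1 / δ)) :=
          Real.exp_le_exp.2 (neg_le_neg hlog)
      _ = δ := by rw [Real.log_div (by norm_num) hδ.ne', Real.log_one, zero_sub, neg_neg,
          Real.exp_log hδ]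

/-- **Lemma 2.14 (sq-sketching).** Given `SQ_ϕ(A)` (`A ≠ 0`) and `S` with `r ≥ 2ϕ² ln(2/δ)` rows
sampled according to `ã` (as printed; `2ϕ² ln(1/δ)` already suffices), the `𝒟_ã`-mass of the
sample sequences `ω` on which `‖S_ωA‖_F² ≥ ½‖A‖_F²` — so that `S_ωA ≠ 0` and the witnesses
`W.sketched ω _ : SQ_{φ_ω}(S_ωA)`, `(W.sketched ω _).transpose : SQ_{φ_ω}((S_ωA)ᵀ)` have
`φ_ω ≤ 2ϕ` (`sketchPhi_le_two_mul`) — is at least `1 − δ`.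
[cite: ChiaEtAl2022, §2.3 Lemma 2.14 ("If `r ≥ 2ϕ² ln(2/δ)`, then with probability `≥ 1−δ`, we
have `SQ_φ(SA)` and `SQ_φ((SA)†)` for some `φ` satisfying `φ ≤ 2ϕ`")] -/
theorem sq_sketching (W : MatrixOversamplingWitness φ A) (hA : A ≠ 0) (hr : 0 < r) {δ : ℝ}
    (hδ : 0 < δ) (hrδ : 2 * φ ^ 2 * Real.log (2 / δ) ≤ r) :
    1 - δ ≤ ∑ ω ∈ univ.filter (fun ω : Fin r → Fin m =>
        frobSq A / 2 ≤ frobSq (sketch (rowDist W.tilde) ω * A) ∧ sketchPhi W ω ≤ 2 * φ),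
      iidWeight (rowDist W.tilde) ω := by
  classical
  have hp := W.isOversampledDist_rowDist hA
  -- `ln(1/δ) ≤ ln(2/δ)`, so the printed hypothesis implies the one of the tail bound
  have hrδ' : 2 * φ ^ 2 * Real.log (1 / δ) ≤ r := by
    refine le_trans (mul_le_mul_of_nonneg_left (Real.log_le_log (by positivity) ?_) (by positivity)) hrδ
    exact div_le_div_of_nonneg_right (by norm_num) hδ.le
  have hbad := iid_mass_frobSq_sketch_lt_half_le W hA hr hδ hrδ'
  -- the good event is the complement of the bad one (and carries `φ_ω ≤ 2ϕ` for free)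
  have hsplit : ∑ ω ∈ univ.filter (fun ω : Fin r → Fin m =>
        frobSq A / 2 ≤ frobSq (sketch (rowDist W.tilde) ω * A) ∧ sketchPhi W ω ≤ 2 * φ),
        iidWeight (rowDist W.tilde) ω =
      ∑ ω ∈ univ.filter (fun ω : Fin r → Fin m =>
        frobSq A / 2 ≤ frobSq (sketch (rowDist W.tilde) ω * A)), iidWeight (rowDist W.tilde) ω := by
    refine sum_congr ?_ fun _ _ => rfl
    ext ω
    simp only [mem_filter, mem_univ, true_and, and_iff_left_iff_imp]
    exact sketchPhi_le_two_mul W hA ω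
  have hcompl : ∑ ω ∈ univ.filter (fun ω : Fin r → Fin m =>
        frobSq A / 2 ≤ frobSq (sketch (rowDist W.tilde) ω * A)), iidWeight (rowDist W.tilde) ω =
      1 - ∑ ω ∈ univ.filter (fun ω : Fin r → Fin m =>
        frobSq (sketch (rowDist W.tilde) ω * A) < frobSq A / 2), iidWeight (rowDist W.tilde) ω := by
    rw [← sum_iidWeight (s := r) hp.sum_eq_one, eq_sub_iff_add_eq, ← sum_filter_add_sum_filter_not
      (s := univ) (p := fun ω : Fin r → Fin m => frobSq A / 2 ≤ frobSq (sketch (rowDist W.tilde) ω * A))]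
    congr 2
    ext ω
    simp only [mem_filter, mem_univ, true_and, not_le]
  rw [hsplit, hcompl]
  linarith

/-! ### Sampling access to `SÃ` and `(SÃ)ᵀ` -/

/-- Degenerate sample sequences (some drawn row has `𝒟_ã`-probability `0`) have weight `0`, so the
access identities below hold almost surely ("each row of `S` is independently chosen to be
`e_i/√(s p(i))` with probability `p_i`"). [cite: ChiaEtAl2022, §2.3 Def. 2.12] -/
theorem iidWeight_eq_zero_of_rowDist_eq_zero (W : MatrixOversamplingWitness φ A) (ω : Fin r → Fin m)
    {t : Fin r} (ht : rowDist W.tilde (ω t) = 0) : iidWeight (rowDist W.tilde) ω = 0 :=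
  prod_eq_zero (mem_univ t) ht

/-- **Row-norm distribution of `S_ωÃ` is uniform on `[r]`** (all rows have squared norm `‖Ã‖_F²/r`),
on non-degenerate sample sequences: `s_φ(SA) = O(1)` row-index sampling. [cite: ChiaEtAl2022, §2.3
Lemma 2.14 ("`s_φ(SA) = 1`") with Remark 2.13] -/
theorem rowDist_sketch_tilde (W : MatrixOversamplingWitness φ A) (hA : A ≠ 0) (ω : Fin r → Fin m)
    (hω : ∀ t, 0 < rowDist W.tilde (ω t)) (t : Fin r) :
    rowDist (sketch (rowDist W.tilde) ω * W.tilde) t = 1 / r := by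
  set p : Fin m → ℝ := rowDist W.tilde with hpdef
  have hr : (0 : ℝ) < r := Nat.cast_pos.2 (Fin.pos t)
  have hFt : 0 < frobSq W.tilde := W.frobSq_tilde_pos hA
  have hrows : ∀ u, normSq ((sketch p ω * W.tilde) u) = frobSq W.tilde / r :=
    fun u => normSq_sketch_tilde_row W ω u (hω u)
  have hfrob : frobSq (sketch p ω * W.tilde) = frobSq W.tilde :=
    calc frobSq (sketch p ω * W.tilde) = ∑ u, normSq ((sketch p ω * W.tilde) u) := rfl
      _ = ∑ _u : Fin r, frobSq W.tilde / r := sum_congr rfl fun u _ => hrows u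
      _ = frobSq W.tilde := by
          rw [sum_const, card_univ, Fintype.card_fin, nsmul_eq_mul]
          field_simp
  calc rowDist (sketch p ω * W.tilde) t
      = normSq ((sketch p ω * W.tilde) t) / frobSq (sketch p ω * W.tilde) := rfl
    _ = 1 / r := by
          rw [hrows t, hfrob]
          field_simp

/-- **Row-norm distribution of `(S_ωÃ)ᵀ`** (the column norms of `S_ωÃ`) **is the uniform mixture of
the row distributions `𝒟_{Ã(ω_t,·)}`**: sample `t ∈ [r]` uniformly, then `j ∼ 𝒟_{Ã(ω_t,·)}` — the
`SQ((SA)†)` row-norm sampler of Lemma 2.14 (`s_φ((SA)†)`: one `SQ_φ(A)` sample), on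
non-degenerate sample sequences. [cite: ChiaEtAl2022, §2.3 Lemma 2.14 (runtimes for
`SQ_φ((SA)†)`)] -/
theorem rowDist_transpose_sketch_tilde (W : MatrixOversamplingWitness φ A) (hA : A ≠ 0)
    (ω : Fin r → Fin m) (hω : ∀ t, 0 < rowDist W.tilde (ω t)) (j : Fin n) :
    rowDist (sketch (rowDist W.tilde) ω * W.tilde)ᵀ j =
      ∑ t, (1 / r : ℝ) * lengthSqDist (W.tilde (ω t)) j := by
  rcases Nat.eq_zero_or_pos r with h0 | hr
  · subst h0
    simp [rowDist, normSq]
  set p : Fin m → ℝ := rowDist W.tilde with hpdef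
  have hr' : (0 : ℝ) < r := Nat.cast_pos.2 hr
  have hFt : 0 < frobSq W.tilde := W.frobSq_tilde_pos hA
  have hrows : ∀ u, normSq ((sketch p ω * W.tilde) u) = frobSq W.tilde / r :=
    fun u => normSq_sketch_tilde_row W ω u (hω u)
  have hfrob : frobSq (sketch p ω * W.tilde) = frobSq W.tilde :=
    calc frobSq (sketch p ω * W.tilde) = ∑ u, normSq ((sketch p ω * W.tilde) u) := rfl
      _ = ∑ _u : Fin r, frobSq W.tilde / r := sum_congr rfl fun u _ => hrows u
      _ = frobSq W.tilde := by
          rw [sum_const, card_univ, Fintype.card_fin, nsmul_eq_mul]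
          field_simp
  have hN : ∀ t, 0 < normSq (W.tilde (ω t)) := fun t =>
    (div_pos_iff_of_pos_right hFt).1 (hω t)
  calc rowDist (sketch p ω * W.tilde)ᵀ j
      = (∑ t, (sketch p ω * W.tilde) t j ^ 2) / frobSq (sketch p ω * W.tilde)ᵀ := rfl
    _ = (∑ t, (sketch p ω * W.tilde) t j ^ 2) / frobSq W.tilde := by rw [frobSq_transpose, hfrob]
    _ = ∑ t, (sketch p ω * W.tilde) t j ^ 2 / frobSq W.tilde := by rw [sum_div]
    _ = ∑ t, (1 / r : ℝ) * lengthSqDist (W.tilde (ω t)) j := by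
          refine sum_congr rfl fun t _ => ?_
          rw [sketch_mul_apply, div_pow, Real.sq_sqrt (le_of_lt (mul_pos hr' (hω t))), hpdef]
          unfold lengthSqDist rowDist
          have h1 := (hN t).ne'
          field_simp

end SampleQuery

end Literature.Computability.QuantumComplexity

end
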